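import Summits.AtomisticToContinuum.FouriersLaw.Theorems.OddSectorIrreversibilityConeScaleCorrectorStubHorizonCorrectorMemLp
import Literature.MathematicalPhysics.KineticTheory.OddSectorLocalityHypothesis

/-!
# `ConeScaleCorrector` (E1), line `GlueInnerCone`, stub C1: the `L²(μ_T)`-contraction on the forecast curve

Support file for crux stmt-AtomisticToContinuum-14069
(`Summit.AtomisticToContinuum.FouriersLaw.Theses.OddSectorIrreversibility.ConeScaleCorrector`), line
`GlueInnerCone`, registered stub C1 `stub_coneTransportBudget` (the `N`-uniform Einstein–Helfand budget of the
finite-horizon Kubo correctors `u_τ = ∫_{(0,τ]} P_tJ_tot dt` of the OPEN equilibrium pinned anharmonic chain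
`pinnedChain ω₂ lam β γ`, both Langevin baths at `T`). Kernel-level, fixed-`N` facts in the crux vocabulary
(`OddSectorLocality.gibbsWeight` = `μ_T = e^{-H/T}·Lebesgue`, `currentForecast t = P_tJ_tot`,
`forecastNormSq = A_N`, `currentNormSq = M_N`):

* `forecastNormSq_le_currentNormSq` — the `L²(μ_T)`-CONTRACTION on the forecast curve,
  `A_N(t) = ‖P_tJ_tot‖² ≤ ‖J_tot‖² = M_N` for every `N` and every real `t` (kernel Gibbs invariance
  `pinnedChain_gibbsMeasure_bind_transitionKernel` + Jensen for the Markov kernels, through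
  `SubdiffusiveBondHeat.pinnedChain_integral_sq_act_le`, transferred from `gibbsMeasure` to `μ_T = Z • gibbsMeasure`);
* `pinnedChain_integral_sq_act_le_of_stronglyMeasurable` — the same contraction for STRONGLY MEASURABLE
  exponentially dominated observables, and with it `forecastNormSq_antitoneOn` — clause (1) of the dictionary of
  `OddSectorLocalityHypothesis`: `t ↦ A_N(t)` is non-increasing on `[0, ∞)` (Chapman–Kolmogorov
  `pinnedChain_transitionKernel_add`, `P_bJ = P_{b-a}(P_aJ)`, and the contraction at `g = P_aJ`);
* `measurable_forecastNormSq`, `integrableOn_forecastNormSq`, `integrableOn_sqrt_forecastNormSq` — `A_N` is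
  measurable and `A_N`, `√A_N` are integrable on every set of finite Lebesgue measure (the honesty hypothesis of
  the fixed-`N` Minkowski-in-time bookkeeping `stub_minkowskiInTime` on bounded intervals);
* `centred_integrable_act_prod_Ioc`, `centred_integrable_sq_act_prod(_Ioc)` — joint integrability of the forecast
  of a centred nice observable and of its square on `gibbsMeasure ⊗ Lebesgue|_{(0,τ]}` (input of the
  Jensen-in-time/Fubini budget of `OddSectorIrreversibilityConeScaleCorrectorStubConeTransportBudget`).

Nothing here closes the crux.
-/

noncomputable section

open MeasureTheory ProbabilityTheory Filter Topology Set
open scoped ENNReal NNReal BigOperators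
open Literature.MathematicalPhysics.KineticTheory.HeatConduction
open Literature.MathematicalPhysics.KineticTheory.OddSectorLocality

namespace Summit.AtomisticToContinuum.FouriersLaw.Theorems.OddSectorIrreversibility

open Summit.AtomisticToContinuum.FouriersLaw.Theorems.LightConeBondHeat
open Summit.AtomisticToContinuum.FouriersLaw.Theorems.SubdiffusiveBondHeat

variable {N : ℕ} {ω₂ lam β γ T : ℝ}

/-! ### The Gibbs weight `μ_T = Z • gibbsMeasure` -/

/-- `μ_T = Z • gibbsMeasure` in the crux vocabulary (`gibbsWeight`). [folklore] -/
theorem gibbsWeight_eq_smul_gibbsMeasure (hω : 0 < ω₂) (hl : 0 ≤ lam) (hβ : 0 ≤ β) (γ : ℝ) (N : ℕ)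
    (hT : 0 < T) :
    gibbsWeight ω₂ lam β γ T N =
      (pinnedChain ω₂ lam β γ).partitionFunction N T • (pinnedChain ω₂ lam β γ).gibbsMeasure N T :=
  withDensity_exp_neg_hamiltonian_eq_smul_gibbsMeasure hω hl hβ γ N hT

/-- `Z.toReal = ∫ e^{-H/T}` (the real mass of `μ_T`). [folklore] -/
theorem toReal_partitionFunction_eq (hω : 0 < ω₂) (hl : 0 ≤ lam) (hβ : 0 ≤ β) (γ : ℝ) (N : ℕ)
    (hT : 0 < T) :
    ((pinnedChain ω₂ lam β γ).partitionFunction N T).toReal =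
      ∫ x, Real.exp (-((pinnedChain ω₂ lam β γ).hamiltonian N x) / T) := by
  rw [(pinnedChain ω₂ lam β γ).partitionFunction_eq_ofReal_integral
      (pinnedChain_integrable_gibbsDensity hω hl hβ γ N hT),
    ENNReal.toReal_ofReal (integral_nonneg fun x => ((pinnedChain ω₂ lam β γ).gibbsDensity_pos N T x).le)]
  rfl

/-- `μ_T` is s-finite (a `withDensity` of Lebesgue measure); a theorem, to be invoked with `haveI`. [folklore] -/
theorem sFinite_gibbsWeight (ω₂ lam β γ T : ℝ) (N : ℕ) : SFinite (gibbsWeight ω₂ lam β γ T N) := by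
  unfold gibbsWeight; infer_instance

/-! ### (a) The `L²(μ_T)`-contraction on the forecast curve -/

/-- (a) on the Gibbs probability measure, `N ≥ 1`: `J² ∈ L¹`, `(P_tJ)² ∈ L¹` and
`∫ (P_tJ)² d(gibbsMeasure) ≤ ∫ J² d(gibbsMeasure)` for every real `t` (time clamped to `t⁺`). [folklore] -/
theorem integral_sq_currentForecast_gibbsMeasure_le (hω : 0 < ω₂) (hl : 0 ≤ lam) (hβ : 0 < β) (hγ : 0 < γ)
    (hN : 0 < N) (hT : 0 < T) (t : ℝ) :
    Integrable (fun x => (∑ i : Fin N, (pinnedChain ω₂ lam β γ).bondCurrent N i x) ^ 2)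
        ((pinnedChain ω₂ lam β γ).gibbsMeasure N T) ∧
    Integrable (fun x => (currentForecast ω₂ lam β γ T N t x) ^ 2) ((pinnedChain ω₂ lam β γ).gibbsMeasure N T) ∧
    ∫ x, (currentForecast ω₂ lam β γ T N t x) ^ 2 ∂((pinnedChain ω₂ lam β γ).gibbsMeasure N T) ≤
      ∫ x, (∑ i : Fin N, (pinnedChain ω₂ lam β γ).bondCurrent N i x) ^ 2
        ∂((pinnedChain ω₂ lam β γ).gibbsMeasure N T) := by
  obtain ⟨hϑ0, h2ϑ⟩ := quarter_inv_temp_admissible hT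
  exact pinnedChain_integral_sq_act_le hω hl hβ hγ hN hT hϑ0 h2ϑ (continuous_totalBondCurrent ω₂ lam β γ N)
    (abs_totalBondCurrent_le_exp hω.le hl hβ.le γ N hϑ0) t.toNNReal

/-- **(a) `forecastNormSq_le_currentNormSq`** — the `L²(μ_T)`-contraction on the forecast curve:
`A_N(t) = ‖P_tJ_tot‖²_{L²(μ_T)} ≤ ‖J_tot‖²_{L²(μ_T)} = M_N` for every `N` and every real `t`
(`μ_T` is `P_t`-invariant at equal bath temperatures and `(P_tJ)² ≤ P_t(J²)` pointwise). [folklore] -/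
theorem forecastNormSq_le_currentNormSq (hω : 0 < ω₂) (hl : 0 ≤ lam) (hβ : 0 < β) (hγ : 0 < γ) (hT : 0 < T)
    (N : ℕ) (t : ℝ) :
    forecastNormSq ω₂ lam β γ T N t ≤ currentNormSq ω₂ lam β γ T N := by
  rcases Nat.eq_zero_or_pos N with rfl | hN
  · simp [forecastNormSq, currentNormSq, currentForecast]
  · obtain ⟨-, -, h⟩ := integral_sq_currentForecast_gibbsMeasure_le hω hl hβ hγ hN hT t
    unfold forecastNormSq currentNormSq
    rw [gibbsWeight_eq_smul_gibbsMeasure hω hl hβ.le γ N hT, integral_smul_measure, integral_smul_measure]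
    exact smul_le_smul_of_nonneg_left h ENNReal.toReal_nonneg

/-- **`L²(gibbsMeasure)`-contraction for strongly measurable observables.** For `N ≥ 1`, `0 < ϑ`, `2ϑ < 1/T`
and a STRONGLY MEASURABLE `g` with `|g| ≤ C e^{ϑH}`: `g² ∈ L¹`, `(P_u g)² ∈ L¹` and
`∫ (P_u g)² d(gibbsMeasure) ≤ ∫ g² d(gibbsMeasure)` — the proof of
`SubdiffusiveBondHeat.pinnedChain_integral_sq_act_le` with continuity weakened to strong measurability (so that it
applies to `g = P_aJ`): Jensen for the Markov kernel `P_u(x, ·)` and kernel Gibbs invariance. [folklore] -/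
theorem pinnedChain_integral_sq_act_le_of_stronglyMeasurable (hω : 0 < ω₂) (hl : 0 ≤ lam) (hβ : 0 < β)
    (hγ : 0 < γ) (hN : 0 < N) (hT : 0 < T) {ϑ C : ℝ} (hϑ0 : 0 < ϑ) (h2ϑ : 2 * ϑ < 1 / T)
    {g : PhaseSpace N → ℝ} (hg : StronglyMeasurable g)
    (hgb : ∀ y, |g y| ≤ C * Real.exp (ϑ * (pinnedChain ω₂ lam β γ).hamiltonian N y)) (u : ℝ≥0) :
    Integrable (fun y => g y ^ 2) ((pinnedChain ω₂ lam β γ).gibbsMeasure N T) ∧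
    Integrable (fun z => (∫ y, g y ∂((pinnedChain ω₂ lam β γ).transitionKernel N T T u z)) ^ 2)
      ((pinnedChain ω₂ lam β γ).gibbsMeasure N T) ∧
    ∫ z, (∫ y, g y ∂((pinnedChain ω₂ lam β γ).transitionKernel N T T u z)) ^ 2
        ∂((pinnedChain ω₂ lam β γ).gibbsMeasure N T) ≤
      ∫ z, g z ^ 2 ∂((pinnedChain ω₂ lam β γ).gibbsMeasure N T) := by
  -- adapted from `SubdiffusiveBondHeat.pinnedChain_integral_sq_act_le` (KernelGibbsF), continuity → measurability
  set P := pinnedChain ω₂ lam β γ with hP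
  set μ := P.gibbsMeasure N T with hμ
  set κ := P.transitionKernel N T T u with hκ
  haveI : IsProbabilityMeasure μ := pinnedChain_isProbabilityMeasure_gibbsMeasure hω hl hβ.le γ N hT
  haveI : IsMarkovKernel κ := pinnedChain_isMarkovKernel_transitionKernel hω hl hβ.le hγ.le N T T u
  have hϑ1 : ϑ < 1 / T := by linarith
  have h2ϑ0 : 0 < 2 * ϑ := by positivity
  have hg2m : StronglyMeasurable fun y => g y ^ 2 := (hg.measurable.pow_const 2).stronglyMeasurable
  have hg2b : ∀ y, |g y ^ 2| ≤ C ^ 2 * Real.exp (2 * ϑ * P.hamiltonian N y) := fun y => by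
    have h1 : Real.exp (2 * ϑ * P.hamiltonian N y) = Real.exp (ϑ * P.hamiltonian N y) ^ 2 := by
      rw [← Real.exp_nat_mul]; congr 1; push_cast; ring
    rw [abs_pow, h1, ← mul_pow]
    exact pow_le_pow_left₀ (abs_nonneg _) (hgb y) 2
  have dom : ∀ {ν : Measure (PhaseSpace N)} {θ D : ℝ} {h : PhaseSpace N → ℝ},
      Integrable (fun y => Real.exp (θ * P.hamiltonian N y)) ν → StronglyMeasurable h →
      (∀ y, |h y| ≤ D * Real.exp (θ * P.hamiltonian N y)) → Integrable h ν :=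
    fun hint hh hle => (hint.const_mul _).mono' hh.aestronglyMeasurable (Eventually.of_forall fun y => by
      rw [Real.norm_eq_abs]; exact hle y)
  have hfκ : ∀ z, Integrable g (κ z) := fun z =>
    dom (pinnedChain_integrable_exp_mul_hamiltonian_transitionKernel hω hl hT hβ.le hγ.le hN hϑ0 hϑ1 u z) hg hgb
  have hf2κ : ∀ z, Integrable (fun y => g y ^ 2) (κ z) := fun z =>
    dom (pinnedChain_integrable_exp_mul_hamiltonian_transitionKernel hω hl hT hβ.le hγ.le hN h2ϑ0 h2ϑ u z) hg2m hg2b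
  have hf2μ : Integrable (fun y => g y ^ 2) μ :=
    dom (pinnedChain_integrable_exp_mul_hamiltonian_gibbsMeasure hω hl hβ.le γ N hT h2ϑ) hg2m hg2b
  set G : PhaseSpace N → ℝ := fun z => ∫ y, g y ∂(κ z) with hG
  have hGm : StronglyMeasurable G := hg.integral_kernel (κ := κ)
  have hjensen : ∀ z, G z ^ 2 ≤ ∫ y, g y ^ 2 ∂(κ z) := by
    intro z
    have hvar : 0 ≤ ∫ y, (g y - G z) ^ 2 ∂(κ z) := integral_nonneg fun y => sq_nonneg _
    have hexp : ∫ y, (g y - G z) ^ 2 ∂(κ z) = (∫ y, g y ^ 2 ∂(κ z)) - G z ^ 2 := by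
      have e : (fun y => (g y - G z) ^ 2) = fun y => g y ^ 2 - (2 * G z) * g y + G z ^ 2 := by
        funext y; ring
      have i1 : Integrable (fun y => g y ^ 2 - 2 * G z * g y) (κ z) := (hf2κ z).sub ((hfκ z).const_mul _)
      rw [e, integral_add i1 (integrable_const _), integral_sub (hf2κ z) ((hfκ z).const_mul _),
        integral_const_mul, integral_const]
      simp only [probReal_univ, smul_eq_mul, one_mul]
      rw [show (∫ y, g y ∂(κ z)) = G z from rfl]
      ring
    linarith
  have hP2int : Integrable (fun z => ∫ y, g y ^ 2 ∂(κ z)) μ := by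
    have hinv := pinnedChain_gibbsMeasure_bind_transitionKernel hω hl hβ.le hγ.le hN hT u
    have h' : (κ ∘ₖ Kernel.const Unit μ) () = μ := by rw [← Measure.comp_eq_comp_const_apply]; exact hinv
    have hf2' : Integrable (fun y => g y ^ 2) ((κ ∘ₖ Kernel.const Unit μ) ()) := by rw [h']; exact hf2μ
    have := hf2'.integral_comp
    rwa [Kernel.const_apply] at this
  have hP2val : ∫ z, (∫ y, g y ^ 2 ∂(κ z)) ∂μ = ∫ z, g z ^ 2 ∂μ :=
    pinnedChain_integral_transitionKernel_gibbsMeasure hω hl hβ.le hγ.le hN hT u hf2μ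
  have hG2int : Integrable (fun z => G z ^ 2) μ :=
    hP2int.mono' (hGm.measurable.pow_const 2).aestronglyMeasurable (Eventually.of_forall fun z => by
      rw [Real.norm_eq_abs, abs_of_nonneg (sq_nonneg _)]; exact hjensen z)
  refine ⟨hf2μ, hG2int, ?_⟩
  rw [← hP2val]
  exact integral_mono_of_nonneg (Eventually.of_forall fun z => sq_nonneg _) hP2int (Eventually.of_forall hjensen)

/-- **`forecastNormSq_antitoneOn`** — clause (1) of the `L²(μ_T)` dictionary: `t ↦ A_N(t)` is non-increasing on
`[0, ∞)` for every `N` (Chapman–Kolmogorov `P_{s+a}J = P_s(P_aJ)` as functions, `pinnedChain_transitionKernel_add`,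
and the contraction applied to the strongly measurable, exponentially dominated `g = P_aJ`). [folklore] -/
theorem forecastNormSq_antitoneOn (hω : 0 < ω₂) (hl : 0 ≤ lam) (hβ : 0 < β) (hγ : 0 < γ) (hT : 0 < T) (N : ℕ) :
    AntitoneOn (forecastNormSq ω₂ lam β γ T N) (Ici 0) := by
  intro a ha b _ hab
  have ha0 : 0 ≤ a := mem_Ici.1 ha
  have hs : 0 ≤ b - a := sub_nonneg.2 hab
  rcases Nat.eq_zero_or_pos N with rfl | hN
  · simp [forecastNormSq, currentForecast]
  · obtain ⟨hϑ0, h2ϑ⟩ := quarter_inv_temp_admissible hT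
    have hϑ1 : 1 / (4 * T) < 1 / T := by linarith
    obtain ⟨K, c, hK, hc, hbd⟩ := pinnedChain_harris_bound hω hl hβ hγ hN hT hϑ0 hϑ1
    have hJc := continuous_totalBondCurrent ω₂ lam β γ N
    have hJb := abs_totalBondCurrent_le_exp hω.le hl hβ.le γ N hϑ0
    have hJ0 := integral_totalBondCurrent_gibbsMeasure hω hl hβ.le γ N hT
    have hC : (0 : ℝ) ≤ N * (N * ((3 + β) / 2) * (2 * Real.exp (1 / (4 * T)) / (1 / (4 * T)) ^ 2)) := by
      have := hβ.le
      positivity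
    -- `g = P_aJ` is strongly measurable and exponentially dominated
    have hgm : StronglyMeasurable (currentForecast ω₂ lam β γ T N a) :=
      hJc.stronglyMeasurable.integral_kernel (κ := (pinnedChain ω₂ lam β γ).transitionKernel N T T a.toNNReal)
    have hgb : ∀ y, |currentForecast ω₂ lam β γ T N a y| ≤
        K * (N * (N * ((3 + β) / 2) * (2 * Real.exp (1 / (4 * T)) / (1 / (4 * T)) ^ 2))) *
          Real.exp (1 / (4 * T) * (pinnedChain ω₂ lam β γ).hamiltonian N y) := fun y => by
      have h := centred_abs_act_le hK.le hbd hc hJc hC hJb hJ0 y a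
      have he : Real.exp (-c * a) ≤ 1 := Real.exp_le_one_iff.2 (by nlinarith)
      have h0 : 0 ≤ K * (N * (N * ((3 + β) / 2) * (2 * Real.exp (1 / (4 * T)) / (1 / (4 * T)) ^ 2))) *
          Real.exp (1 / (4 * T) * (pinnedChain ω₂ lam β γ).hamiltonian N y) :=
        mul_nonneg (mul_nonneg hK.le hC) (Real.exp_pos _).le
      calc |currentForecast ω₂ lam β γ T N a y| ≤ _ := h
        _ ≤ K * (N * (N * ((3 + β) / 2) * (2 * Real.exp (1 / (4 * T)) / (1 / (4 * T)) ^ 2))) *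
              Real.exp (1 / (4 * T) * (pinnedChain ω₂ lam β γ).hamiltonian N y) * 1 :=
            mul_le_mul_of_nonneg_left he h0
        _ = _ := mul_one _
    -- Chapman–Kolmogorov on functions: `P_bJ = P_{b-a}(P_aJ)`
    have hba : b.toNNReal = (b - a).toNNReal + a.toNNReal := by
      rw [← Real.toNNReal_add hs ha0, sub_add_cancel]
    have hck : ∀ x, currentForecast ω₂ lam β γ T N b x =
        ∫ y, currentForecast ω₂ lam β γ T N a y
          ∂((pinnedChain ω₂ lam β γ).transitionKernel N T T (b - a).toNNReal x) := by
      intro x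
      have hJint : Integrable (fun y => ∑ i : Fin N, (pinnedChain ω₂ lam β γ).bondCurrent N i y)
          (((pinnedChain ω₂ lam β γ).transitionKernel N T T a.toNNReal ∘ₖ
            (pinnedChain ω₂ lam β γ).transitionKernel N T T (b - a).toNNReal) x) := by
        rw [← pinnedChain_transitionKernel_add hω hl hβ.le hγ.le N T T, ← hba]
        exact integrable_of_abs_le_exp
          (pinnedChain_integrable_exp_mul_hamiltonian_transitionKernel hω hl hT hβ.le hγ.le hN hϑ0 hϑ1 _ x) hJc hJb
      unfold currentForecast
      rw [hba, pinnedChain_transitionKernel_add hω hl hβ.le hγ.le N T T, Kernel.integral_comp hJint]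
    have key := (pinnedChain_integral_sq_act_le_of_stronglyMeasurable hω hl hβ hγ hN hT hϑ0 h2ϑ hgm hgb
      (b - a).toNNReal).2.2
    show forecastNormSq ω₂ lam β γ T N b ≤ forecastNormSq ω₂ lam β γ T N a
    unfold forecastNormSq
    simp_rw [hck]
    rw [gibbsWeight_eq_smul_gibbsMeasure hω hl hβ.le γ N hT, integral_smul_measure, integral_smul_measure]
    exact smul_le_smul_of_nonneg_left key ENNReal.toReal_nonneg

/-- `0 ≤ A_N(t)`. [folklore] -/
theorem forecastNormSq_nonneg (ω₂ lam β γ T : ℝ) (N : ℕ) (t : ℝ) : 0 ≤ forecastNormSq ω₂ lam β γ T N t :=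
  integral_nonneg fun _ => sq_nonneg _

/-- `0 ≤ M_N`. [folklore] -/
theorem currentNormSq_nonneg (ω₂ lam β γ T : ℝ) (N : ℕ) : 0 ≤ currentNormSq ω₂ lam β γ T N :=
  integral_nonneg fun _ => sq_nonneg _

/-- `(t, x) ↦ P_tJ_tot(x)` is jointly (strongly) measurable. [folklore] -/
theorem stronglyMeasurable_currentForecast_uncurry (hω : 0 < ω₂) (hl : 0 ≤ lam) (hβ : 0 ≤ β) (hγ : 0 ≤ γ)
    (T : ℝ) (N : ℕ) :
    StronglyMeasurable fun q : ℝ × PhaseSpace N => currentForecast ω₂ lam β γ T N q.1 q.2 :=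
  pinnedChain_stronglyMeasurable_act_uncurry hω hl hβ hγ T T (continuous_totalBondCurrent ω₂ lam β γ N).measurable

/-- `t ↦ A_N(t)` is measurable. [folklore] -/
theorem measurable_forecastNormSq (hω : 0 < ω₂) (hl : 0 ≤ lam) (hβ : 0 ≤ β) (hγ : 0 ≤ γ) (T : ℝ) (N : ℕ) :
    Measurable (forecastNormSq ω₂ lam β γ T N) := by
  haveI := sFinite_gibbsWeight ω₂ lam β γ T N
  have h := (stronglyMeasurable_currentForecast_uncurry hω hl hβ hγ T N).measurable.pow_const 2
  exact (h.stronglyMeasurable.integral_prod_right' (ν := gibbsWeight ω₂ lam β γ T N)).measurable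

/-- `A_N` is integrable on every set of finite Lebesgue measure (`0 ≤ A_N ≤ M_N`). [folklore] -/
theorem integrableOn_forecastNormSq (hω : 0 < ω₂) (hl : 0 ≤ lam) (hβ : 0 < β) (hγ : 0 < γ) (hT : 0 < T)
    (N : ℕ) {s : Set ℝ} (hs : volume s ≠ ∞) :
    IntegrableOn (forecastNormSq ω₂ lam β γ T N) s := by
  haveI : IsFiniteMeasure (volume.restrict s) := ⟨by rwa [Measure.restrict_apply_univ, lt_top_iff_ne_top]⟩
  refine Integrable.mono' (integrable_const (currentNormSq ω₂ lam β γ T N))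
    (measurable_forecastNormSq hω hl hβ.le hγ.le T N).aestronglyMeasurable (Eventually.of_forall fun t => ?_)
  rw [Real.norm_eq_abs, abs_of_nonneg (forecastNormSq_nonneg ω₂ lam β γ T N t)]
  exact forecastNormSq_le_currentNormSq hω hl hβ hγ hT N t

/-- `√A_N` is integrable on every set of finite Lebesgue measure — in particular on every `(A, S]`, the
honesty hypothesis of the fixed-`N` Minkowski-in-time bookkeeping. [folklore] -/
theorem integrableOn_sqrt_forecastNormSq (hω : 0 < ω₂) (hl : 0 ≤ lam) (hβ : 0 < β) (hγ : 0 < γ) (hT : 0 < T)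
    (N : ℕ) {s : Set ℝ} (hs : volume s ≠ ∞) :
    IntegrableOn (fun t => Real.sqrt (forecastNormSq ω₂ lam β γ T N t)) s := by
  haveI : IsFiniteMeasure (volume.restrict s) := ⟨by rwa [Measure.restrict_apply_univ, lt_top_iff_ne_top]⟩
  refine Integrable.mono' (integrable_const (Real.sqrt (currentNormSq ω₂ lam β γ T N)))
    ((measurable_forecastNormSq hω hl hβ.le hγ.le T N).sqrt.aestronglyMeasurable)
    (Eventually.of_forall fun t => ?_)
  rw [Real.norm_eq_abs, abs_of_nonneg (Real.sqrt_nonneg _)]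
  exact Real.sqrt_le_sqrt (forecastNormSq_le_currentNormSq hω hl hβ hγ hT N t)

/-! ### Joint integrability of the forecast of a centred nice observable -/

section Centred

/-! For a centred nice observable `f` (`μ_T(f) = 0`, `|f| ≤ C e^{ϑH}`, Harris constants `K, c`, as in
`OddSectorIrreversibilityConeScaleCorrectorStubCentredCorrector`): joint integrability of the forecast and of its
square on `gibbsMeasure ⊗ Lebesgue|_{(0,τ]}`. -/

variable {ϑ K c C : ℝ} {f : PhaseSpace N → ℝ} (hK : 0 ≤ K)
  (hb : ∀ (z : PhaseSpace N) (t : ℝ≥0) (f : PhaseSpace N → ℝ), Continuous f →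
    ∀ C : ℝ, 0 ≤ C → (∀ y, |f y| ≤ C * Real.exp (ϑ * (pinnedChain ω₂ lam β γ).hamiltonian N y)) →
    |(∫ y, f y ∂((pinnedChain ω₂ lam β γ).transitionKernel N T T t z)) -
        ∫ y, f y ∂((pinnedChain ω₂ lam β γ).gibbsMeasure N T)| ≤
      K * C * Real.exp (ϑ * (pinnedChain ω₂ lam β γ).hamiltonian N z) * Real.exp (-c * t))
  (hc : 0 < c) (hf : Continuous f) (hC : 0 ≤ C)
  (hfb : ∀ y, |f y| ≤ C * Real.exp (ϑ * (pinnedChain ω₂ lam β γ).hamiltonian N y))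
  (hf0 : ∫ y, f y ∂((pinnedChain ω₂ lam β γ).gibbsMeasure N T) = 0)
include hK hb hc hf hC hfb hf0

/-- `(z, t) ↦ P_{t⁺} f(z)` is integrable on `gibbsMeasure ⊗ Lebesgue|_{(0,τ]}` (restriction of
`centred_integrable_act_prod`). [folklore] -/
theorem centred_integrable_act_prod_Ioc (hω : 0 < ω₂) (hl : 0 ≤ lam) (hβ : 0 ≤ β) (hγ : 0 ≤ γ) (hT : 0 < T)
    (hϑ1 : ϑ < 1 / T) (τ : ℝ) :
    Integrable (Function.uncurry fun (z : PhaseSpace N) (t : ℝ) =>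
        ∫ y, f y ∂((pinnedChain ω₂ lam β γ).transitionKernel N T T t.toNNReal z))
      (((pinnedChain ω₂ lam β γ).gibbsMeasure N T).prod (volume.restrict (Ioc (0 : ℝ) τ))) :=
  (centred_integrable_act_prod hK hb hc hf hC hfb hf0 hω hl hβ hγ hT hϑ1).mono_measure
    (Measure.prod_mono le_rfl (Measure.restrict_mono Ioc_subset_Ioi_self le_rfl))

/-- `(z, t) ↦ (P_{t⁺} f(z))²` is integrable on `gibbsMeasure ⊗ Lebesgue|_{(0,∞)}` when `2ϑ < 1/T`
(dominated by `(KC)² e^{2ϑH(z)} · e^{-2ct}`). [folklore] -/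
theorem centred_integrable_sq_act_prod (hω : 0 < ω₂) (hl : 0 ≤ lam) (hβ : 0 ≤ β) (hγ : 0 ≤ γ) (hT : 0 < T)
    (h2ϑ : 2 * ϑ < 1 / T) :
    Integrable (Function.uncurry fun (z : PhaseSpace N) (t : ℝ) =>
        (∫ y, f y ∂((pinnedChain ω₂ lam β γ).transitionKernel N T T t.toNNReal z)) ^ 2)
      (((pinnedChain ω₂ lam β γ).gibbsMeasure N T).prod (volume.restrict (Ioi (0 : ℝ)))) := by
  have hmeas : AEStronglyMeasurable (Function.uncurry fun (z : PhaseSpace N) (t : ℝ) =>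
        (∫ y, f y ∂((pinnedChain ω₂ lam β γ).transitionKernel N T T t.toNNReal z)) ^ 2)
      (((pinnedChain ω₂ lam β γ).gibbsMeasure N T).prod (volume.restrict (Ioi (0 : ℝ)))) :=
    (((pinnedChain_stronglyMeasurable_act_uncurry hω hl hβ hγ T T hf.measurable).comp_measurable
      measurable_swap).measurable.pow_const 2).aestronglyMeasurable
  have h2c : 0 < 2 * c := by positivity
  have hdom : Integrable (fun q : PhaseSpace N × ℝ =>
      ((K * C) ^ 2 * Real.exp (2 * ϑ * (pinnedChain ω₂ lam β γ).hamiltonian N q.1)) * Real.exp (-(2 * c) * q.2))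
      (((pinnedChain ω₂ lam β γ).gibbsMeasure N T).prod (volume.restrict (Ioi (0 : ℝ)))) :=
    ((pinnedChain_integrable_exp_mul_hamiltonian_gibbsMeasure hω hl hβ γ N hT h2ϑ).const_mul ((K * C) ^ 2)).mul_prod
      (exp_neg_integrableOn_Ioi 0 h2c)
  refine hdom.mono' hmeas (Eventually.of_forall fun q => ?_)
  have h := centred_abs_act_le hK hb hc hf hC hfb hf0 q.1 q.2
  have hsq := pow_le_pow_left₀ (abs_nonneg _) h 2
  have e1 : Real.exp (2 * ϑ * (pinnedChain ω₂ lam β γ).hamiltonian N q.1) =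
      Real.exp (ϑ * (pinnedChain ω₂ lam β γ).hamiltonian N q.1) ^ 2 := by
    rw [← Real.exp_nat_mul]; congr 1; push_cast; ring
  have e2 : Real.exp (-(2 * c) * q.2) = Real.exp (-c * q.2) ^ 2 := by
    rw [← Real.exp_nat_mul]; congr 1; push_cast; ring
  simp only [Function.uncurry, norm_pow, Real.norm_eq_abs]
  rw [e1, e2]
  calc |∫ y, f y ∂((pinnedChain ω₂ lam β γ).transitionKernel N T T q.2.toNNReal q.1)| ^ 2
      ≤ (K * C * Real.exp (ϑ * (pinnedChain ω₂ lam β γ).hamiltonian N q.1) * Real.exp (-c * q.2)) ^ 2 := hsq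
    _ = (K * C) ^ 2 * Real.exp (ϑ * (pinnedChain ω₂ lam β γ).hamiltonian N q.1) ^ 2 *
          Real.exp (-c * q.2) ^ 2 := by ring

/-- Restriction of `centred_integrable_sq_act_prod` to `(0, τ]`. [folklore] -/
theorem centred_integrable_sq_act_prod_Ioc (hω : 0 < ω₂) (hl : 0 ≤ lam) (hβ : 0 ≤ β) (hγ : 0 ≤ γ) (hT : 0 < T)
    (h2ϑ : 2 * ϑ < 1 / T) (τ : ℝ) :
    Integrable (Function.uncurry fun (z : PhaseSpace N) (t : ℝ) =>
        (∫ y, f y ∂((pinnedChain ω₂ lam β γ).transitionKernel N T T t.toNNReal z)) ^ 2)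
      (((pinnedChain ω₂ lam β γ).gibbsMeasure N T).prod (volume.restrict (Ioc (0 : ℝ) τ))) :=
  (centred_integrable_sq_act_prod hK hb hc hf hC hfb hf0 hω hl hβ hγ hT h2ϑ).mono_measure
    (Measure.prod_mono le_rfl (Measure.restrict_mono Ioc_subset_Ioi_self le_rfl))

end Centred


/-! ### The registered sub-goal of C1 proved by this file -/

/-- **Sub-goal `stub_coneTransportBudget_contraction` of C1** (registered on stmt-AtomisticToContinuum-14069; fixed
`N`, every `N`): the forecast curve `t ↦ A_N(t) = ‖P_tJ_tot‖²_{L²(μ_T)}` of the open equilibrium chain is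
non-increasing on `[0, ∞)` and bounded by `M_N = ‖J_tot‖²_{L²(μ_T)}` at every real time — the `L²(μ_T)`-contraction
half of the Einstein–Helfand budget (`forecastNormSq_antitoneOn`, `forecastNormSq_le_currentNormSq`). [folklore] -/
theorem stub_coneTransportBudget_contraction :
    ∀ ω₂ lam β γ : ℝ, 0 < ω₂ → 0 ≤ lam → 0 < β → 0 < γ → ∀ T : ℝ, 0 < T → ∀ N : ℕ,
      AntitoneOn (Literature.MathematicalPhysics.KineticTheory.OddSectorLocality.forecastNormSq ω₂ lam β γ T N)
          (Set.Ici 0) ∧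
        ∀ t : ℝ, Literature.MathematicalPhysics.KineticTheory.OddSectorLocality.forecastNormSq ω₂ lam β γ T N t ≤
          Literature.MathematicalPhysics.KineticTheory.OddSectorLocality.currentNormSq ω₂ lam β γ T N :=
  fun _ _ _ _ hω hl hβ hγ _ hT N =>
    ⟨forecastNormSq_antitoneOn hω hl hβ hγ hT N, fun t => forecastNormSq_le_currentNormSq hω hl hβ hγ hT N t⟩

end Summit.AtomisticToContinuum.FouriersLaw.Theorems.OddSectorIrreversibility
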